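import Summits.ResolutionOfSingularities.ResolutionOfSingularities.Theorems.EquisingularLiftEquisingularLiftNatDirectionChartIdeal
import Literature.AlgebraicGeometry.Modules.PullbackUnitSections
import HarnessLib

/-!
# [OURS · L1 W4.5b · T-DIRLIFT-UP route C, brick B7 of C1c] Transport lemmas: pulled-back linear relations, sections killed by a
# closed subscheme, and the transition unit of two presentations of a direction

Cell res-hironaka, LADDER-RESOLUTION rung L, slot W4.5(b), crux chain w45b (EL♮(3) = stmt-ResolutionOfSingularities-20148); object
T-DIRLIFT-UP (res-L1-w45b-plan-1 RULING 19:14:55Z, route C), brick C1c (`L/res-D-pv-051/TARGET-C1c.sig.lean` b928b225abc4a457), sub-brick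
B7 (generic lemmas; the C1c assembly consumes them for the pairwise proportionality `hprop`).
`--supports stmt-ResolutionOfSingularities-20148 --as helper`. THEOREMS ONLY; def-free; NOT a statement of any manuscript; AI-written,
AI review weaker than expert review.

WHAT.
* `map_unitSection_eq_sum`: a linear relation `σ′|_B = Σ_l n_l σ_l|_B` among sections of an `𝒪_Y`-module `E` pulls back along
  `f : X → Y` to the same relation among the unit sections `η(σ′)`, `η(σ_l)` of `f^*E` with coefficients `f♯(n_l)` (Hartshorne II.5,
  `η(r b) = f♯(r) η(b)`); iterated three times (`ι_C`, `ε`, `g`) it carries the change of generators `x′ = N x` of the ideal of `C` to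
  the pulled-back conormal frames;
* `appLE_comp_subschemeι_eq_zero_of_mem`, `appLE_comp_subschemeι_eq_of_sub_mem`: sections of `Ī(W)` die under
  `(ψ ≫ ι_{V(Ī)})♯`, so congruences mod `Ī` become equalities on `Y′`;
* `exists_unit_of_presentations_eq` (ideal side): on an affine `W ∋ y` with `Ī(W) = (ℓ₀, ℓ₁)`, `y ∈ Supp Ī` carrying a quasi-regular
  2-frame, if `(Σ α_j ℓ_j) + Ī(W)² = (Σ α″_j ℓ_j) + Ī(W)²` with `α` unimodular mod `Ī(W)`, then `α″_j ≡ u α_j (mod Ī)` on an affine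
  `W′ ⊆ W` around `y` for a section `u` (ring core `exists_unit_of_coords_eq` p561783 at the stalk, B1 p565463, spreading B6).
-/

noncomputable section

open CategoryTheory AlgebraicGeometry Opposite TopologicalSpace IsLocalRing
open Literature.AlgebraicGeometry.Resolution Literature.AlgebraicGeometry.Modules

set_option linter.dupNamespace false -- mandated namespace `Summit.<Summit>.<Problem>` of this single-conjunct summit

namespace Summit.ResolutionOfSingularities.ResolutionOfSingularities.Cruxes.EquisingularLiftNat.Sections

universe u

/-! ## 1. Pulling back a linear relation among sections -/

/-- **Pulled-back linear relations.** If `σ′|_B = Σ_l n_l · σ_l|_B` in `Γ(E, B)` (`B ≤ A, A′`), then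
`η(σ′)|_{f⁻¹B} = Σ_l f♯(n_l) · η(σ_l)|_{f⁻¹B}` in `Γ(f^*E, f⁻¹B)`. [cite: Hartshorne1977, II.5 (p. 110)] -/
theorem map_unitSection_eq_sum {X Y : Scheme.{u}} (f : X ⟶ Y) (E : Y.Modules) {A A' B : Y.Opens} (kA : B ⟶ A) (kA' : B ⟶ A')
    {I : Type*} [Fintype I] (σ : I → Γ(E, A)) (σ' : Γ(E, A')) (n : I → Γ(Y, B))
    (h : E.presheaf.map kA'.op σ' = ∑ l, n l • E.presheaf.map kA.op (σ l)) :
    ((Scheme.Modules.pullback f).obj E).presheaf.map ((Opens.map f.base).map kA').op (unitSection f E A' σ') =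
      ∑ l, f.app B (n l) •
        ((Scheme.Modules.pullback f).obj E).presheaf.map ((Opens.map f.base).map kA).op (unitSection f E A (σ l)) := by
  rw [← unitSection_map, h, unitSection_sum]
  refine Finset.sum_congr rfl fun l _ => ?_
  rw [unitSection_smul, ← unitSection_map]

/-! ## 2. Sections killed by a closed subscheme -/

/-- **Sections of `Ī(W)` die on `V(Ī)`**: for `ψ : Y′ → V(Ī)` and `s ∈ Ī(W)` (`W` affine), `(ψ ≫ ι)♯(s) = 0`. [folklore] -/
theorem appLE_comp_subschemeι_eq_zero_of_mem {G₀ Y' : Scheme.{u}} (Ī : G₀.IdealSheafData) (ψ : Y' ⟶ Ī.subscheme)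
    (W : G₀.affineOpens) (V : Y'.Opens) (e : V ≤ (ψ ≫ Ī.subschemeι) ⁻¹ᵁ (W : G₀.Opens)) {s : Γ(G₀, W)} (hs : s ∈ Ī.ideal W) :
    (ψ ≫ Ī.subschemeι).appLE W V e s = 0 := by
  have hker : Ī.subschemeι.app W s = 0 := by
    have h : s ∈ Ī.subschemeι.ker.ideal W := by rwa [Scheme.IdealSheafData.ker_subschemeι]
    rw [Scheme.Hom.ker_apply] at h
    exact h
  rw [Scheme.Hom.comp_appLE, CommRingCat.comp_apply, hker, map_zero]

/-- Congruences mod `Ī(W)` become equalities under `(ψ ≫ ι)♯`. [folklore] -/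
theorem appLE_comp_subschemeι_eq_of_sub_mem {G₀ Y' : Scheme.{u}} (Ī : G₀.IdealSheafData) (ψ : Y' ⟶ Ī.subscheme)
    (W : G₀.affineOpens) (V : Y'.Opens) (e : V ≤ (ψ ≫ Ī.subschemeι) ⁻¹ᵁ (W : G₀.Opens)) {a b : Γ(G₀, W)}
    (h : a - b ∈ Ī.ideal W) : (ψ ≫ Ī.subschemeι).appLE W V e a = (ψ ≫ Ī.subschemeι).appLE W V e b := by
  rw [← sub_eq_zero, ← map_sub]
  exact appLE_comp_subschemeι_eq_zero_of_mem Ī ψ W V e h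

/-! ## 3. The transition unit of two presentations of a direction (ideal side) -/

variable {G₀ : Scheme.{u}}

/-- **Two presentations of a direction differ by a unit mod `Ī`, on a neighbourhood.** `W ∋ y` affine, `Ī(W) = (ℓ₀, ℓ₁)`, `y ∈ Supp Ī`
with a quasi-regular 2-frame of `Ī_y`; if `(Σ_j α_j ℓ_j) + Ī(W)² = (Σ_j α″_j ℓ_j) + Ī(W)²` and `Σ_j a_j α_j − 1 ∈ Ī(W)`, then on some
affine `W′ ⊆ W` around `y`: `α″_j − u·α_j ∈ Ī(W′)` (`j = 0, 1`) for a section `u ∈ Γ(G₀, W′)`. [cite: StacksProject, Tag 063H] -/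
theorem exists_unit_of_presentations_eq (Ī : G₀.IdealSheafData) (W : G₀.affineOpens) {y : G₀} (hy : y ∈ (W : G₀.Opens))
    (hyS : y ∈ Ī.support) (hfr : ∃ c : Fin 2 → G₀.presheaf.stalk y, Ideal.span (Set.range c) = stalkIdeal Ī y ∧ IsQuasiRegular c)
    (ℓ : Fin 2 → Γ(G₀, W)) (hℓ : Ī.ideal W = Ideal.span (Set.range ℓ)) (α a α'' : Fin 2 → Γ(G₀, W))
    (hu : (∑ j, a j * α j - 1) ∈ Ī.ideal W)
    (h : Ideal.span {∑ j, α j * ℓ j} ⊔ (Ī.ideal W) ^ 2 = Ideal.span {∑ j, α'' j * ℓ j} ⊔ (Ī.ideal W) ^ 2) :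
    ∃ (W' : G₀.affineOpens) (hW' : (W' : G₀.Opens) ≤ W) (_ : y ∈ (W' : G₀.Opens)) (u : Γ(G₀, W')),
      ∀ j, secRes G₀ hW' (α'' j) - u * secRes G₀ hW' (α j) ∈ Ī.ideal W' := by
  classical
  obtain ⟨c', hc'span, hc'qr⟩ := hfr
  -- the chart germs
  set c : Fin 2 → G₀.presheaf.stalk y := fun j => (G₀.presheaf.germ W y hy).hom (ℓ j) with hc
  have hcspan : Ideal.span (Set.range c) = stalkIdeal Ī y := by
    rw [stalkIdeal_eq_map_germ Ī W hy, hℓ, Ideal.map_span, ← Set.range_comp]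
    rfl
  have h𝔪 : Ideal.span (Set.range c') ≤ maximalIdeal (G₀.presheaf.stalk y) := by
    rw [hc'span]; exact (mem_support_iff_stalkIdeal_le Ī y).mp hyS
  have hcqr : IsQuasiRegular c := isQuasiRegular_of_span_eq hc'qr h𝔪 (hcspan.trans hc'span.symm)
  -- the two presentations at the stalk
  set φ := (G₀.presheaf.germ W y hy).hom with hφ
  have hIW : (Ī.ideal W).map φ = Ideal.span (Set.range c) := by rw [hcspan, hφ, ← stalkIdeal_eq_map_germ Ī W hy]
  have key : Ideal.span {φ (α 0) * c 0 + φ (α 1) * c 1} ⊔ Ideal.span (Set.range c) ^ 2 =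
      Ideal.span {φ (α'' 0) * c 0 + φ (α'' 1) * c 1} ⊔ Ideal.span (Set.range c) ^ 2 := by
    have h' := congrArg (Ideal.map φ) h
    rw [Ideal.map_sup, Ideal.map_sup, Ideal.map_pow, Ideal.map_span, Ideal.map_span, Set.image_singleton, Set.image_singleton,
      hIW, Fin.sum_univ_two, Fin.sum_univ_two, map_add, map_add, map_mul, map_mul, map_mul, map_mul] at h'
    exact h'
  have hu' : ∃ x y : G₀.presheaf.stalk y, x * φ (α 0) + y * φ (α 1) - 1 ∈ Ideal.span (Set.range c) := by
    refine ⟨φ (a 0), φ (a 1), ?_⟩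
    have h' := Ideal.mem_map_of_mem φ hu
    rw [hIW, Fin.sum_univ_two, map_sub, map_add, map_mul, map_mul, map_one] at h'
    exact h'
  obtain ⟨u₀, -, h0, h1, -, -, -⟩ := exists_unit_of_coords_eq hcqr key hu'
  -- spread `u₀` to a section and the two congruences to a basic open
  obtain ⟨r₁, hyr₁, u, hu₁⟩ := exists_basicOpen_section_of_germ W hy u₀
  have hW₁ : (G₀.affineBasicOpen r₁ : G₀.Opens) ≤ W := G₀.basicOpen_le r₁
  have hgerm : ∀ j, (G₀.presheaf.germ (G₀.affineBasicOpen r₁) y hyr₁).hom (secRes G₀ hW₁ (α'' j) - u * secRes G₀ hW₁ (α j)) ∈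
      stalkIdeal Ī y := by
    intro j
    rw [map_sub, map_mul, hu₁, germ_secRes, germ_secRes, ← hcspan]
    fin_cases j
    · exact h0
    · exact h1
  obtain ⟨r₂, hyr₂, hm0⟩ := exists_basicOpen_res_mem_ideal Ī (G₀.affineBasicOpen r₁) hyr₁ _ (hgerm 0)
  have hW₂ : (G₀.affineBasicOpen r₂ : G₀.Opens) ≤ G₀.affineBasicOpen r₁ := G₀.basicOpen_le r₂
  have hgerm1 : (G₀.presheaf.germ (G₀.affineBasicOpen r₂) y hyr₂).hom
      (secRes G₀ hW₂ (secRes G₀ hW₁ (α'' 1) - u * secRes G₀ hW₁ (α 1))) ∈ stalkIdeal Ī y := by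
    rw [germ_secRes]
    exact hgerm 1
  obtain ⟨r₃, hyr₃, hm1⟩ := exists_basicOpen_res_mem_ideal Ī (G₀.affineBasicOpen r₂) hyr₂ _ hgerm1
  have hW₃ : (G₀.affineBasicOpen r₃ : G₀.Opens) ≤ G₀.affineBasicOpen r₂ := G₀.basicOpen_le r₃
  have H0 : secRes G₀ (hW₃.trans (hW₂.trans hW₁)) (α'' 0) - secRes G₀ (hW₃.trans hW₂) u * secRes G₀ (hW₃.trans (hW₂.trans hW₁)) (α 0) ∈
      Ī.ideal (G₀.affineBasicOpen r₃) := by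
    have hm0' : secRes G₀ hW₂ (secRes G₀ hW₁ (α'' 0) - u * secRes G₀ hW₁ (α 0)) ∈ Ī.ideal (G₀.affineBasicOpen r₂) := hm0
    have h' : secRes G₀ hW₃ (secRes G₀ hW₂ (secRes G₀ hW₁ (α'' 0) - u * secRes G₀ hW₁ (α 0))) ∈ Ī.ideal (G₀.affineBasicOpen r₃) := by
      rw [← map_secRes_ideal Ī hW₃]
      exact Ideal.mem_map_of_mem _ hm0'
    have e : secRes G₀ (hW₃.trans (hW₂.trans hW₁)) (α'' 0) - secRes G₀ (hW₃.trans hW₂) u * secRes G₀ (hW₃.trans (hW₂.trans hW₁)) (α 0) =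
        secRes G₀ hW₃ (secRes G₀ hW₂ (secRes G₀ hW₁ (α'' 0) - u * secRes G₀ hW₁ (α 0))) := by
      simp only [map_sub, map_mul, secRes_secRes]
    rw [e]
    exact h'
  have H1 : secRes G₀ (hW₃.trans (hW₂.trans hW₁)) (α'' 1) - secRes G₀ (hW₃.trans hW₂) u * secRes G₀ (hW₃.trans (hW₂.trans hW₁)) (α 1) ∈
      Ī.ideal (G₀.affineBasicOpen r₃) := by
    have h' : secRes G₀ hW₃ (secRes G₀ hW₂ (secRes G₀ hW₁ (α'' 1) - u * secRes G₀ hW₁ (α 1))) ∈ Ī.ideal (G₀.affineBasicOpen r₃) :=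
      hm1
    have e : secRes G₀ (hW₃.trans (hW₂.trans hW₁)) (α'' 1) - secRes G₀ (hW₃.trans hW₂) u * secRes G₀ (hW₃.trans (hW₂.trans hW₁)) (α 1) =
        secRes G₀ hW₃ (secRes G₀ hW₂ (secRes G₀ hW₁ (α'' 1) - u * secRes G₀ hW₁ (α 1))) := by
      simp only [map_sub, map_mul, secRes_secRes]
    rw [e]
    exact h'
  refine ⟨G₀.affineBasicOpen r₃, hW₃.trans (hW₂.trans hW₁), hyr₃, secRes G₀ (hW₃.trans hW₂) u, fun j => ?_⟩
  fin_cases j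
  exacts [H0, H1]

end Summit.ResolutionOfSingularities.ResolutionOfSingularities.Cruxes.EquisingularLiftNat.Sections

end
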